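import Summits.ResolutionOfSingularities.ResolutionOfSingularities.Theorems.WeightedInvariantIota3EpsStratumRing
import Summits.ResolutionOfSingularities.ResolutionOfSingularities.Theorems.WeightedInvariantIotaSqueeze
import Literature.AlgebraicGeometry.Resolution.RegularLocusPerfectField
import Literature.AlgebraicGeometry.Resolution.CanonicalResolution
import Literature.AlgebraicGeometry.Resolution.CanonicalResolutionProofs
import Literature.AlgebraicGeometry.Resolution.StalkIdealLemmas
import HarnessLib

/-!
# Clause (c8ε): the P3 letter `ε` is upper semicontinuous along the `ν`-strata — unconditionally over PERFECT ground
# fields, and over every field modulo «fields are J-2» (Matsumura, Cor. to Thm. 30.5) — door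
# `HypersurfaceCentreConstruction` (stmt-ResolutionOfSingularities-19897), route `WeightedInvariant`, rung P3, ORDER (o32-ι-a‴)

[OURS · L1 W4.3 · cell `res-hironaka`, HUMAN RULING D-0089] Helper file `--supports stmt-ResolutionOfSingularities-19897`
(res-type-047, res-L1-w43-plan-1's OFFER (o32-ι-a‴) in DEALS gen 10 #8 (3), IOTA3-DESIGN v1 §2.2: «(c8ε|ν)
`IotaUpperSemicontinuousOn iotaOrd iotaEps` — on a smooth quasi-compact `Y` over a field `k₀`, inside the stratum
`{ν = α}` the set `{ε = 1}` is the NON-REGULAR LOCUS of the reduced closed subscheme `Σ_α`, which must be closed …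
CAVEAT: (c8) quantifies over ANY field `k₀`; over an imperfect `k₀` regular ≠ smooth … state and prove the perfect-field
case first, report the gap»).  CANDIDATE DESIGN OBJECTS ONLY (`iotaEps` is res-type-013's typed letter, p527087);
nothing here is a statement of the manuscript under review (Hironaka 2017, [claim: Hironaka2017, status: under-review]);
nothing is attributed to its author; nothing here claims anything about resolution of singularities.  AI work, weaker
than expert review.

## The argument

For `y` on the stratum `E_α = {ν = α}` of `Y` (smooth over `k₀`), let `F_α = {α ≤ ν}` (CLOSED: (c8) for `ν`,
res-type-039's `iotaOrd_upperSemicontinuous`) and `I` its radical ideal sheaf (`Scheme.IdealSheafData.vanishingIdeal`).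
On an affine chart `U = Spec A ∋ y` with `J = I(U)` (the radical ideal of `F_α ∩ U`), the primes `q ≤ 𝔭_y` with `J ≤ q`
are the generisations `z ⤳ y` with `α ≤ ν(z)`, i.e. — by (c7) for `ν` (`iota_localization_le_of_le`) — exactly those with
`ν(z) = ν(y)`; so the ring lemma `Iota3.iotaEps_eq_one_iff_not_isRegularLocalRing_quotient` of the companion file reads
**`ε(y) = 1 ⟺ 𝒪_{Y,y} ⧸ I_y` is NOT a regular local ring**.  Hence the set
`C = {y ∈ F_α | 𝒪_{Y,y} ⧸ I_y not regular}` has trace `{ν = α ∧ ε = 1}` on the stratum, and `C ∩ U` is the image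
under `Spec A → Y` of the image under the closed embedding `Spec (A ⧸ J) → Spec A` of the NON-REGULAR LOCUS
`Spec (A ⧸ J) ∖ Reg(A ⧸ J)` (`Iota3.isRegularLocalRing_quotient_map_iff`: `𝒪_{Y,z} ⧸ J·𝒪_{Y,z} = (A ⧸ J)_{q_z ⧸ J}`).
So `C` is closed as soon as `Reg(B)` is open for every finitely generated `k₀`-algebra `B` — the J-2 property of the
field `k₀`:

* `k₀` PERFECT: PROVED in the tree (`isOpen_regularLocus_of_perfectField`, `Literature/…/RegularLocusPerfectField`:
  regular = smooth over a perfect field, Matsumura §30 Rem. 2, + Mathlib's `Algebra.isOpen_smoothLocus`) ⇒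
  **`iotaEps_upperSemicontinuousOn_of_perfectField`** (unconditional);
* ANY `k₀`: «`Reg(B)` is open for every finitely generated algebra `B` over a field» is Matsumura's Corollary to
  Thm. 30.5 (fields are J-2; for imperfect `k₀` the regular locus can exceed the smooth locus, e.g. `k₀[t]/(t^p − a)`),
  the tree's NAMED FACT `Matsumura1987_30_5_cor` (`Literature/…/CanonicalResolution`, undischarged) ⇒
  **`iotaEps_upperSemicontinuousOn_of_J2 : Matsumura1987_30_5_cor → IotaUpperSemicontinuousOn iotaOrd iotaEps`**
  (the registered clause (c8ε) VERBATIM, modulo that published fact).  THIS is the imperfect-`k₀` gap of the memo,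
  located: nothing beyond J-2 of the ground field is used.

## Main statements

* `iotaEps_stratum_inter_eq_of_isOpen_regularLocus` — the common core: `∃ C` closed with
  `C ∩ {ν = α} = {ν = α ∧ β ≤ ε}`, for `k₀` with `Reg` open on finitely generated `k₀`-algebras.
* `iotaEps_upperSemicontinuousOn_of_perfectField`, `iotaEps_upperSemicontinuousOn_of_J2`.

## References

* res-L1-w43-plan-1, `L/res-L1-w43-plan-1/IOTA3-DESIGN.md` v1 §2.2 (OURS, AI planning); res-type-078 `IOTA3-INPUT.md` v1.1 §2.
* H. Matsumura, *Commutative Ring Theory*, CUP 1986, §30 Remark 2 after Thm. 30.3 and Corollary to Thm. 30.5; §32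
  p. 260 (J-2). [cite: Matsumura1987, §30 Cor. to Thm. 30.5]
-/

noncomputable section

set_option linter.dupNamespace false -- mandated namespace `Summit.<Summit>.<Problem>` of this single-conjunct summit

open CategoryTheory AlgebraicGeometry TopologicalSpace IsLocalRing Topology
open Literature.AlgebraicGeometry.Resolution
open Summit.ResolutionOfSingularities.ResolutionOfSingularities.Theorems (ContactCylinder.topStratum)
open Summit.ResolutionOfSingularities.ResolutionOfSingularities.Theorems.ContactCylinder

namespace Summit.ResolutionOfSingularities.ResolutionOfSingularities.Cruxes.HypersurfaceCentreConstruction.LocalEngine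

namespace Iota3

/-! ## §3 Affine charts: points of `Spec Γ(Y, U)`, germs, and the order function -/

section Chart

variable {Y : Scheme.{0}} (U : Y.affineOpens)

/-- Points of the chart lie in `U`. [folklore] -/
theorem fromSpec_mem (q : PrimeSpectrum Γ(Y, U)) : U.2.fromSpec q ∈ (U : Y.Opens) :=
  U.2.range_fromSpec.le ⟨q, rfl⟩

/-- `primeIdealOf ∘ fromSpec = id` (`fromSpec` is injective). [folklore] -/
theorem primeIdealOf_fromSpec (q : PrimeSpectrum Γ(Y, U)) (hq : U.2.fromSpec q ∈ (U : Y.Opens)) :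
    U.2.primeIdealOf ⟨U.2.fromSpec q, hq⟩ = q := by
  apply U.2.fromSpec.isOpenEmbedding.injective
  rw [IsAffineOpen.fromSpec_primeIdealOf]

/-- **`ν` on a chart**: for `y ∈ U`, `iotaOrd 𝒪_{Y,y} (f_y) = iotaOrd (Γ(Y,U)_{𝔭_y}) (f|_U / 1)` ((c6) along
`Γ(Y,U)_{𝔭_y} ≃ 𝒪_{Y,y}`). [OURS] -/
theorem iotaOrd_germ_eq_iotaOrd_localization (f : Γ(Y, ⊤)) {y : Y} (hy : y ∈ (U : Y.Opens)) :
    iotaOrd (Y.presheaf.stalk y) (Y.presheaf.germ ⊤ y trivial f) =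
      iotaOrd (Localization.AtPrime (U.2.primeIdealOf ⟨y, hy⟩).asIdeal)
        (algebraMap Γ(Y, U) (Localization.AtPrime (U.2.primeIdealOf ⟨y, hy⟩).asIdeal)
          (Y.presheaf.map (homOfLE le_top).op f)) := by
  have hres : stalkEquiv U hy (algebraMap Γ(Y, U) (Localization.AtPrime (U.2.primeIdealOf ⟨y, hy⟩).asIdeal)
      (Y.presheaf.map (homOfLE le_top).op f)) = (Y.presheaf.germ ⊤ y trivial) f := by
    rw [stalkEquiv_algebraMap]
    exact TopCat.Presheaf.germ_res_apply Y.presheaf (homOfLE le_top) y hy f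
  have h6 := iotaOrd_isoInvariant _ _ (stalkEquiv U hy)
    (algebraMap Γ(Y, U) (Localization.AtPrime (U.2.primeIdealOf ⟨y, hy⟩).asIdeal)
      (Y.presheaf.map (homOfLE le_top).op f))
  rw [hres] at h6
  exact h6

/-- **`ν` at a point of the chart**: `iotaOrd 𝒪_{Y, fromSpec q} (f) = iotaOrd (Γ(Y,U)_q) (f|_U / 1)`. [OURS] -/
theorem iotaOrd_germ_fromSpec_eq (f : Γ(Y, ⊤)) (q : PrimeSpectrum Γ(Y, U)) :
    iotaOrd (Y.presheaf.stalk (U.2.fromSpec q)) (Y.presheaf.germ ⊤ (U.2.fromSpec q) trivial f) =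
      iotaOrd (Localization.AtPrime q.asIdeal)
        (algebraMap Γ(Y, U) (Localization.AtPrime q.asIdeal) (Y.presheaf.map (homOfLE le_top).op f)) := by
  rw [iotaOrd_germ_eq_iotaOrd_localization U f (fromSpec_mem U q), primeIdealOf_fromSpec U q (fromSpec_mem U q)]

/-- A closed set read on the chart is the zero locus of its vanishing ideal: `fromSpec q ∈ F ↔ I(F ∩ U) ≤ q`.
[folklore] -/
theorem vanishingIdeal_preimage_le_iff {F : Set Y} (hF : IsClosed F) (q : PrimeSpectrum Γ(Y, U)) :
    PrimeSpectrum.vanishingIdeal (U.2.fromSpec ⁻¹' F) ≤ q.asIdeal ↔ U.2.fromSpec q ∈ F := by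
  have hc : IsClosed (X := PrimeSpectrum Γ(Y, U)) (U.2.fromSpec ⁻¹' F) := hF.preimage U.2.fromSpec.continuous
  have h1 : q ∈ PrimeSpectrum.zeroLocus (PrimeSpectrum.vanishingIdeal (U.2.fromSpec ⁻¹' F) : Set Γ(Y, U)) ↔
      q ∈ U.2.fromSpec ⁻¹' F := by
    rw [PrimeSpectrum.zeroLocus_vanishingIdeal_eq_closure, hc.closure_eq]
    exact Iff.rfl
  rw [PrimeSpectrum.mem_zeroLocus, SetLike.coe_subset_coe] at h1
  exact h1

/-- **`𝒪_{Y,z} ⧸ I_z = (A ⧸ J)_{q ⧸ J}`** for `z = fromSpec q`, `J = I(U) ≤ q`: the stalk quotient is regular iff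
`q ⧸ J ∈ Reg(Γ(Y,U) ⧸ J)`. [folklore] -/
theorem isRegularLocalRing_stalk_quotient_stalkIdeal_iff (I : Y.IdealSheafData) (q : PrimeSpectrum Γ(Y, U))
    (hJq : I.ideal U ≤ q.asIdeal) [(q.asIdeal.map (Ideal.Quotient.mk (I.ideal U))).IsPrime] :
    IsRegularLocalRing (Y.presheaf.stalk (U.2.fromSpec q) ⧸ stalkIdeal I (U.2.fromSpec q)) ↔
      IsRegularLocalRing (Localization.AtPrime (q.asIdeal.map (Ideal.Quotient.mk (I.ideal U)))) := by
  letI := TopCat.Presheaf.algebra_section_stalk Y.presheaf (⟨U.2.fromSpec q, fromSpec_mem U q⟩ : (U : Y.Opens))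
  haveI : IsLocalization.AtPrime (Y.presheaf.stalk (U.2.fromSpec q)) q.asIdeal :=
    U.2.isLocalization_stalk' q (fromSpec_mem U q)
  rw [stalkIdeal_eq_map_germ I U (fromSpec_mem U q)]
  exact isRegularLocalRing_quotient_map_iff (I.ideal U) q.asIdeal (Y.presheaf.stalk (U.2.fromSpec q)) hJq

end Chart

/-! ## §4 `ε` on a smooth scheme: the chart hypothesis, and `ε = 1 ⟺ 𝒪_{Y,y} ⧸ I_y` not regular on the stratum -/

section Smooth

variable {k₀ : Type} [Field k₀] {Y : Scheme.{0}} (hY : Y ⟶ Spec (CommRingCat.of k₀)) [Smooth hY] (f : Γ(Y, ⊤))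

include hY in
/-- The local rings of the affine charts of the smooth `Y` are regular. [folklore] -/
theorem isRegularLocalRing_localization_primeIdealOf (U : Y.affineOpens) {y : Y} (hy : y ∈ (U : Y.Opens)) :
    IsRegularLocalRing (Localization.AtPrime (U.2.primeIdealOf ⟨y, hy⟩).asIdeal) :=
  haveI := isRegularLocalRing_stalk_of_smooth_of_field hY y
  IsRegularLocalRing.of_ringEquiv (stalkEquiv U hy).symm

include hY in
/-- **The chart hypothesis of the ring lemma holds on the strata.**  For `y ∈ U` with `ν(y) = α` and `J` the vanishing
ideal of `F_α ∩ U`, `F_α = {α ≤ ν}`: among the primes `q ≤ 𝔭_y` of `Γ(Y,U)`, `J ≤ q` iff `f|_U` has at `Γ(Y,U)_q` its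
order at `Γ(Y,U)_{𝔭_y}` — by (c7) for `ν` the generisations of `y` have order `≤ α`. [OURS] -/
theorem vanishingIdeal_le_iff_iotaOrd_eq (U : Y.affineOpens) (α : Ordinal.{0})
    (hF : IsClosed {z : Y | α ≤ iotaOrd (Y.presheaf.stalk z) (Y.presheaf.germ ⊤ z trivial f)})
    {y : Y} (hy : y ∈ (U : Y.Opens)) (hα : iotaOrd (Y.presheaf.stalk y) (Y.presheaf.germ ⊤ y trivial f) = α)
    (q : Ideal Γ(Y, U)) [q.IsPrime] (hq : q ≤ (U.2.primeIdealOf ⟨y, hy⟩).asIdeal) :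
    PrimeSpectrum.vanishingIdeal
        (U.2.fromSpec ⁻¹' {z : Y | α ≤ iotaOrd (Y.presheaf.stalk z) (Y.presheaf.germ ⊤ z trivial f)}) ≤ q ↔
      iotaOrd (Localization.AtPrime q)
          (algebraMap Γ(Y, U) (Localization.AtPrime q) (Y.presheaf.map (homOfLE le_top).op f)) =
        iotaOrd (Localization.AtPrime (U.2.primeIdealOf ⟨y, hy⟩).asIdeal)
          (algebraMap Γ(Y, U) (Localization.AtPrime (U.2.primeIdealOf ⟨y, hy⟩).asIdeal)
            (Y.presheaf.map (homOfLE le_top).op f)) := by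
  haveI := isRegularLocalRing_localization_primeIdealOf hY U hy
  -- the order at `y` on the chart is `α`, and the order at `q` is at most `α` ((c7))
  have hy' : iotaOrd (Localization.AtPrime (U.2.primeIdealOf ⟨y, hy⟩).asIdeal)
      (algebraMap Γ(Y, U) (Localization.AtPrime (U.2.primeIdealOf ⟨y, hy⟩).asIdeal)
        (Y.presheaf.map (homOfLE le_top).op f)) = α := by
    rw [← iotaOrd_germ_eq_iotaOrd_localization U f hy, hα]
  have hle : iotaOrd (Localization.AtPrime q)
      (algebraMap Γ(Y, U) (Localization.AtPrime q) (Y.presheaf.map (homOfLE le_top).op f)) ≤ α := by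
    rw [← hy']
    exact iota_localization_le_of_le iotaOrd iotaOrd_isoInvariant iotaOrd_generizationMonotone hq _
  -- the point `z = fromSpec q` of the chart: `J ≤ q ↔ z ∈ F_α ↔ α ≤ ν(z)`, and `ν(z)` is the order at `q`
  have hz := vanishingIdeal_preimage_le_iff U hF ⟨q, ‹_›⟩
  rw [Set.mem_setOf_eq, iotaOrd_germ_fromSpec_eq U f ⟨q, ‹_›⟩] at hz
  change _ ≤ q ↔ α ≤ iotaOrd (Localization.AtPrime q) _ at hz
  rw [hz, hy']
  exact ⟨fun h => le_antisymm hle h, fun h => h.ge⟩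

include hY in
/-- **`ε = 1` on the stratum ⟺ the stalk of the reduced super-level set is not regular.**  For `y` with `ν(y) = α`
and `I` the vanishing ideal sheaf of the closed set `F_α = {α ≤ ν}`:
`iotaEps 𝒪_{Y,y} (f_y) = 1 ↔ ¬ IsRegularLocalRing (𝒪_{Y,y} ⧸ I_y)`. [OURS] -/
theorem iotaEps_germ_eq_one_iff (α : Ordinal.{0})
    (hF : IsClosed {z : Y | α ≤ iotaOrd (Y.presheaf.stalk z) (Y.presheaf.germ ⊤ z trivial f)})
    {y : Y} (hα : iotaOrd (Y.presheaf.stalk y) (Y.presheaf.germ ⊤ y trivial f) = α) :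
    iotaEps (Y.presheaf.stalk y) (Y.presheaf.germ ⊤ y trivial f) = 1 ↔
      ¬ IsRegularLocalRing (Y.presheaf.stalk y ⧸
        stalkIdeal (Scheme.IdealSheafData.vanishingIdeal
          ⟨{z : Y | α ≤ iotaOrd (Y.presheaf.stalk z) (Y.presheaf.germ ⊤ z trivial f)}, hF⟩) y) := by
  -- an affine chart through `y`
  have hytop : y ∈ (⊤ : Y.Opens) := trivial
  rw [← iSup_affineOpens_eq_top Y] at hytop
  obtain ⟨U, hy⟩ := Opens.mem_iSup.mp hytop
  letI := TopCat.Presheaf.algebra_section_stalk Y.presheaf (⟨y, hy⟩ : (U : Y.Opens))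
  haveI : IsLocalization.AtPrime (Y.presheaf.stalk y) (U.2.primeIdealOf ⟨y, hy⟩).asIdeal :=
    U.2.isLocalization_stalk ⟨y, hy⟩
  -- the germ is `f|_U / 1`, the stalk ideal is `J · 𝒪_{Y,y}`
  have hres : (Y.presheaf.germ ⊤ y trivial).hom f =
      algebraMap Γ(Y, U) (Y.presheaf.stalk y) (Y.presheaf.map (homOfLE le_top).op f) :=
    (TopCat.Presheaf.germ_res_apply Y.presheaf (homOfLE le_top) y hy f).symm
  rw [stalkIdeal_eq_map_germ _ U hy, Scheme.IdealSheafData.vanishingIdeal_ideal]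
  change iotaEps (Y.presheaf.stalk y) ((Y.presheaf.germ ⊤ y trivial).hom f) = 1 ↔ _
  rw [hres]
  exact iotaEps_eq_one_iff_not_isRegularLocalRing_quotient (U.2.primeIdealOf ⟨y, hy⟩).asIdeal
    (Y.presheaf.stalk y) (Y.presheaf.map (homOfLE le_top).op f) _ (PrimeSpectrum.isRadical_vanishingIdeal _)
    (fun q _ hq => vanishingIdeal_le_iff_iotaOrd_eq hY f U α hF hy hα q hq)

/-- **The chart of `C = {y ∈ F_α | 𝒪_{Y,y} ⧸ I_y not regular}`**: on an affine `U = Spec A` with `J = I(U)`,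
`fromSpec ⁻¹' C` is the image under `Spec (A ⧸ J) → Spec A` of the NON-REGULAR LOCUS of `A ⧸ J`. [OURS] -/
theorem fromSpec_preimage_nonRegular_eq (U : Y.affineOpens) {F : Set Y} (hF : IsClosed F) :
    U.2.fromSpec ⁻¹' {y : Y | y ∈ F ∧ ¬ IsRegularLocalRing (Y.presheaf.stalk y ⧸
        stalkIdeal (Scheme.IdealSheafData.vanishingIdeal ⟨F, hF⟩) y)} =
      PrimeSpectrum.comap (Ideal.Quotient.mk ((Scheme.IdealSheafData.vanishingIdeal ⟨F, hF⟩).ideal U)) ''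
        (regularLocus (Γ(Y, U) ⧸ (Scheme.IdealSheafData.vanishingIdeal ⟨F, hF⟩).ideal U))ᶜ := by
  set I : Y.IdealSheafData := Scheme.IdealSheafData.vanishingIdeal ⟨F, hF⟩ with hI
  have hJ : I.ideal U = PrimeSpectrum.vanishingIdeal (U.2.fromSpec ⁻¹' F) :=
    Scheme.IdealSheafData.vanishingIdeal_ideal ⟨F, hF⟩ U
  have hker : RingHom.ker (Ideal.Quotient.mk (I.ideal U)) = I.ideal U := Ideal.mk_ker
  ext q
  simp only [Set.mem_preimage, Set.mem_setOf_eq]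
  constructor
  · rintro ⟨hqF, hnreg⟩
    have hJq : I.ideal U ≤ q.asIdeal := by
      rw [hJ]; exact (vanishingIdeal_preimage_le_iff U hF q).mpr hqF
    haveI := isPrime_map_quotient_mk (I.ideal U) q.asIdeal hJq
    refine ⟨⟨q.asIdeal.map (Ideal.Quotient.mk (I.ideal U)), this⟩, ?_, ?_⟩
    · rwa [isRegularLocalRing_stalk_quotient_stalkIdeal_iff U I q hJq] at hnreg
    · ext1
      rw [PrimeSpectrum.comap_asIdeal, Ideal.comap_map_of_surjective _ Ideal.Quotient.mk_surjective,
        ← RingHom.ker_eq_comap_bot, hker, sup_eq_left.mpr hJq]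
  · rintro ⟨𝔔, hnreg, rfl⟩
    have hJq : I.ideal U ≤ (PrimeSpectrum.comap (Ideal.Quotient.mk (I.ideal U)) 𝔔).asIdeal := by
      intro x hx
      rw [PrimeSpectrum.comap_asIdeal, Ideal.mem_comap, Ideal.Quotient.eq_zero_iff_mem.mpr hx]
      exact zero_mem _
    have h𝔔 : (PrimeSpectrum.comap (Ideal.Quotient.mk (I.ideal U)) 𝔔).asIdeal.map
        (Ideal.Quotient.mk (I.ideal U)) = 𝔔.asIdeal := by
      rw [PrimeSpectrum.comap_asIdeal, Ideal.map_comap_of_surjective _ Ideal.Quotient.mk_surjective]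
    haveI : ((PrimeSpectrum.comap (Ideal.Quotient.mk (I.ideal U)) 𝔔).asIdeal.map
        (Ideal.Quotient.mk (I.ideal U))).IsPrime := by rw [h𝔔]; exact 𝔔.isPrime
    refine ⟨by rw [← vanishingIdeal_preimage_le_iff U hF, ← hJ]; exact hJq, ?_⟩
    rw [isRegularLocalRing_stalk_quotient_stalkIdeal_iff U I _ hJq]
    intro hreg
    apply hnreg
    -- the two primes coincide, so both local rings are localizations at the same submonoid
    have hM : ((PrimeSpectrum.comap (Ideal.Quotient.mk (I.ideal U)) 𝔔).asIdeal.map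
        (Ideal.Quotient.mk (I.ideal U))).primeCompl = 𝔔.asIdeal.primeCompl := by
      ext x; simp only [Ideal.mem_primeCompl_iff, h𝔔]
    haveI : IsLocalization 𝔔.asIdeal.primeCompl
        (Localization.AtPrime ((PrimeSpectrum.comap (Ideal.Quotient.mk (I.ideal U)) 𝔔).asIdeal.map
          (Ideal.Quotient.mk (I.ideal U)))) := by
      rw [← hM]
      exact Localization.isLocalization
    let e : Localization.AtPrime ((PrimeSpectrum.comap (Ideal.Quotient.mk (I.ideal U)) 𝔔).asIdeal.map
        (Ideal.Quotient.mk (I.ideal U))) ≃+* Localization.AtPrime 𝔔.asIdeal :=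
      (IsLocalization.algEquiv 𝔔.asIdeal.primeCompl
        (Localization.AtPrime ((PrimeSpectrum.comap (Ideal.Quotient.mk (I.ideal U)) 𝔔).asIdeal.map
          (Ideal.Quotient.mk (I.ideal U)))) (Localization.AtPrime 𝔔.asIdeal)).toRingEquiv
    exact IsRegularLocalRing.of_ringEquiv e

/-- **(c8ε), the common core.**  On a smooth quasi-compact `Y` over a field `k₀` such that `Reg(B)` is open for every
finitely generated `k₀`-algebra `B` (J-2), for every `f ∈ Γ(Y, 𝒪_Y)` and ordinals `α, β` there is a CLOSED `C ⊆ Y`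
with `C ∩ {ν = α} = {ν = α ∧ β ≤ ε}` (`ν = iotaOrd`, `ε = iotaEps` at the stalk germs of `f`): `C = Y` for `β = 0`,
`C = ∅` for `β > 1`, and otherwise `C = {y ∈ {α ≤ ν} | 𝒪_{Y,y} ⧸ I_y not regular}`, `I` the radical ideal sheaf of
the closed set `{α ≤ ν}`. [OURS] -/
theorem iotaEps_stratum_inter_eq_of_isOpen_regularLocus [QuasiCompact hY]
    (hJ2 : ∀ (B : Type) [CommRing B] [Algebra k₀ B], Algebra.FiniteType k₀ B → IsOpen (regularLocus B))
    (α β : Ordinal.{0}) :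
    ∃ C : Set Y, IsClosed C ∧
      C ∩ {y : Y | iotaOrd (Y.presheaf.stalk y) (Y.presheaf.germ ⊤ y trivial f) = α} =
        {y : Y | iotaOrd (Y.presheaf.stalk y) (Y.presheaf.germ ⊤ y trivial f) = α ∧
          β ≤ iotaEps (Y.presheaf.stalk y) (Y.presheaf.germ ⊤ y trivial f)} := by
  classical
  -- trivial thresholds: `ε ∈ {0, 1}`
  rcases eq_or_ne β 0 with rfl | hβ0
  · exact ⟨Set.univ, isClosed_univ, by ext y; simp⟩
  by_cases hβ1 : β ≤ 1
  swap
  · refine ⟨∅, isClosed_empty, ?_⟩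
    ext y
    simp only [Set.empty_inter, Set.mem_empty_iff_false, Set.mem_setOf_eq, false_iff, not_and]
    intro _ hβ
    apply hβ1
    rcases iotaEps_eq_zero_or_eq_one (Y.presheaf.stalk y) (Y.presheaf.germ ⊤ y trivial f) with h | h
    · rw [h] at hβ; exact hβ.trans zero_le_one
    · rw [h] at hβ; exact hβ
  have hβε : ∀ y : Y, β ≤ iotaEps (Y.presheaf.stalk y) (Y.presheaf.germ ⊤ y trivial f) ↔
      iotaEps (Y.presheaf.stalk y) (Y.presheaf.germ ⊤ y trivial f) = 1 := fun y => by
    rcases iotaEps_eq_zero_or_eq_one (Y.presheaf.stalk y) (Y.presheaf.germ ⊤ y trivial f) with h | h <;> rw [h]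
    · simp only [nonpos_iff_eq_zero, zero_ne_one, iff_false]
      exact hβ0
    · simp only [hβ1]
  -- the closed super-level set `F_α` and the candidate `C`
  have hF : IsClosed {z : Y | α ≤ iotaOrd (Y.presheaf.stalk z) (Y.presheaf.germ ⊤ z trivial f)} :=
    iotaOrd_upperSemicontinuous k₀ Y hY f α
  set F : Set Y := {z : Y | α ≤ iotaOrd (Y.presheaf.stalk z) (Y.presheaf.germ ⊤ z trivial f)} with hFdef
  set I : Y.IdealSheafData := Scheme.IdealSheafData.vanishingIdeal ⟨F, hF⟩ with hIdef
  refine ⟨{y : Y | y ∈ F ∧ ¬ IsRegularLocalRing (Y.presheaf.stalk y ⧸ stalkIdeal I y)}, ?_, ?_⟩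
  · -- `C` is closed: on each affine chart it is the image of the non-regular locus of `Γ(Y,U) ⧸ J`
    have hcov : IsOpenCover (fun U : Y.affineOpens => (U : Y.Opens)) := iSup_affineOpens_eq_top Y
    rw [← isOpen_compl_iff, hcov.isOpen_iff_inter]
    intro U
    -- `Γ(Y, U)` and `Γ(Y, U) ⧸ J` are finitely generated `k₀`-algebras
    letI algk : Algebra k₀ Γ(Y, U) :=
      ((hY.appLE ⊤ (U : Y.Opens) le_top).hom.comp (Scheme.ΓSpecIso (.of k₀)).inv.hom).toAlgebra
    haveI : Algebra.FiniteType k₀ Γ(Y, U) := by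
      have h1 : (hY.appLE ⊤ (U : Y.Opens) le_top).hom.FiniteType :=
        HasRingHomProperty.appLE @LocallyOfFiniteType hY inferInstance ⟨⊤, isAffineOpen_top _⟩ U le_top
      exact h1.comp (RingHom.FiniteType.of_surjective _
        (Scheme.ΓSpecIso (.of k₀)).commRingCatIsoToRingEquiv.symm.surjective)
    haveI : Algebra.FiniteType k₀ (Γ(Y, U) ⧸ I.ideal U) :=
      Algebra.FiniteType.of_surjective (Ideal.Quotient.mkₐ k₀ (I.ideal U)) (Ideal.Quotient.mkₐ_surjective k₀ (I.ideal U))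
    have hT : IsClosed (PrimeSpectrum.comap (Ideal.Quotient.mk (I.ideal U)) ''
        (regularLocus (Γ(Y, U) ⧸ I.ideal U))ᶜ) :=
      (PrimeSpectrum.isClosedEmbedding_comap_of_surjective _ _ Ideal.Quotient.mk_surjective).isClosedMap _
        (hJ2 _ inferInstance).isClosed_compl
    have hpre := fromSpec_preimage_nonRegular_eq U hF
    have himg : {y : Y | y ∈ F ∧ ¬ IsRegularLocalRing (Y.presheaf.stalk y ⧸ stalkIdeal I y)}ᶜ ∩
        ((U : Y.Opens) : Set Y) =
        U.2.fromSpec '' (U.2.fromSpec ⁻¹'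
          {y : Y | y ∈ F ∧ ¬ IsRegularLocalRing (Y.presheaf.stalk y ⧸ stalkIdeal I y)})ᶜ := by
      rw [Set.image_compl_preimage, IsAffineOpen.range_fromSpec, Set.sdiff_eq_compl_inter]
    rw [himg, hpre]
    exact U.2.fromSpec.isOpenEmbedding.isOpenMap _ hT.isOpen_compl
  · -- the trace on the stratum `{ν = α}`
    ext y
    simp only [Set.mem_inter_iff, Set.mem_setOf_eq]
    constructor
    · rintro ⟨⟨_, hnreg⟩, hνα⟩
      exact ⟨hνα, (hβε y).mpr ((iotaEps_germ_eq_one_iff hY f α hF hνα).mpr hnreg)⟩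
    · rintro ⟨hνα, hβ⟩
      exact ⟨⟨hνα.symm.le, (iotaEps_germ_eq_one_iff hY f α hF hνα).mp ((hβε y).mp hβ)⟩, hνα⟩

/-- **(c8ε) over a PERFECT ground field — unconditional.**  For `k₀` perfect, `Y` smooth and quasi-compact over `k₀`,
`f ∈ Γ(Y, 𝒪_Y)` and ordinals `α, β`: `{ν = α ∧ β ≤ ε}` is the trace on the stratum `{ν = α}` of a closed subset of
`Y` (the shape of `IotaUpperSemicontinuousOn iotaOrd iotaEps`, which quantifies over all fields).  The J-2 input is
the tree's `isOpen_regularLocus_of_perfectField` (regular = smooth over a perfect field).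
[cite: Matsumura1987, §30 Remark 2 after Thm. 30.3] [OURS] -/
theorem iotaEps_upperSemicontinuousOn_of_perfectField (k₀ : Type) [Field k₀] [PerfectField k₀] (Y : Scheme.{0})
    (hY : Y ⟶ Spec (CommRingCat.of k₀)) [Smooth hY] [QuasiCompact hY] (f : Γ(Y, ⊤)) (α β : Ordinal.{0}) :
    ∃ C : Set Y, IsClosed C ∧
      C ∩ {y : Y | iotaOrd (Y.presheaf.stalk y) (Y.presheaf.germ ⊤ y trivial f) = α} =
        {y : Y | iotaOrd (Y.presheaf.stalk y) (Y.presheaf.germ ⊤ y trivial f) = α ∧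
          β ≤ iotaEps (Y.presheaf.stalk y) (Y.presheaf.germ ⊤ y trivial f)} :=
  iotaEps_stratum_inter_eq_of_isOpen_regularLocus hY f
    (fun B _ _ hB => by haveI := hB; exact isOpen_regularLocus_of_perfectField k₀ B) α β

/-- **(c8ε) over EVERY field, modulo «fields are J-2»** (Matsumura, Cor. to Thm. 30.5: `Reg(B)` is open for every
finitely generated algebra `B` over a field — the tree's named fact `Matsumura1987_30_5_cor`, undischarged):
`IotaUpperSemicontinuousOn iotaOrd iotaEps` VERBATIM.  This locates the imperfect-ground-field gap of IOTA3-DESIGN v1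
§2.2: nothing beyond the J-2 property of `k₀` is used. [cite: Matsumura1987, §30 Cor. to Thm. 30.5] [OURS] -/
theorem iotaEps_upperSemicontinuousOn_of_J2 (h : Matsumura1987_30_5_cor.{0}) :
    IotaUpperSemicontinuousOn iotaOrd iotaEps := by
  intro k₀ _ Y hY _ _ f α β
  exact iotaEps_stratum_inter_eq_of_isOpen_regularLocus hY f (fun B _ _ hB => h k₀ B hB) α β

end Smooth


/-! ## §5 (rev 2) The J-2 input IS in the tree: (c8ε) unconditionally over every field -/

section Unconditional

/-- **(c8ε) over EVERY field — UNCONDITIONAL.**  The named fact «fields are J-2» (Matsumura, Cor. to Thm. 30.5) used by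
`iotaEps_upperSemicontinuousOn_of_J2` is DISCHARGED in the tree (`Matsumura1987_30_5_cor_holds`,
`Literature/…/CanonicalResolutionProofs.lean`, via «finitely generated algebras over a field are excellent»,
`Stacks07QW_field_holds`): hence `IotaUpperSemicontinuousOn iotaOrd iotaEps` holds outright — the registered
stratum-relative clause (c8) for the second key `ε`, on every smooth quasi-compact scheme over every field, in every
dimension.  (Rev 2 correction of the «imperfect-field gap» wording of the module docstring: there is no gap.)
[cite: Matsumura1987, §30 Cor. to Thm. 30.5] [OURS] -/
theorem iotaEps_upperSemicontinuousOn : IotaUpperSemicontinuousOn iotaOrd iotaEps :=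
  iotaEps_upperSemicontinuousOn_of_J2 Matsumura1987_30_5_cor_holds

/-- **(c8) for the pair `(ν ; ε) = iotaOrdEps` — UNCONDITIONAL, unrestricted** (every field, every dimension): the first key
`ν` is upper semicontinuous (res-type-039's `iotaOrd_upperSemicontinuous`), the second key `ε` is bounded by `ω` and upper
semicontinuous along the `ν`-strata (`iotaEps_upperSemicontinuousOn`), and (c8) transfers along lexicographic pairs
(res-type-073's `iotaLex_iotaOrd_upperSemicontinuous`). [OURS] -/
theorem iotaOrdEps_upperSemicontinuous : IotaUpperSemicontinuous iotaOrdEps :=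
  iotaLex_iotaOrd_upperSemicontinuous Ordinal.omega0_ne_zero iotaEps_boundedBy_omega0 iotaEps_upperSemicontinuousOn

end Unconditional

end Iota3

end Summit.ResolutionOfSingularities.ResolutionOfSingularities.Cruxes.HypersurfaceCentreConstruction.LocalEngine

end
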